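import Summits.ABC.IUTFork.Repair.RHSigmaStrataEqDatum
import Summits.ABC.IUTFork.Repair.RHHullCapacityNecessaryLin
import Literature.IUT.LogVolume.IntegerRingFinite
import HarnessLib

/-!
# R-H row 3 «hull-capacity-necessary» — `RHHullCapacityNecessaryAnti`: the [ED] cell (and the [LIN] cell) is ANTITONE IN THE LABEL at EVERY place
# of EVERY pilot datum, with NO local-type hypothesis; Σ₃ is an initial segment of labels at every prime; «whole place in Σ₃ ⟺ its top cell»

PROOF-ONLY file of the abc-iut cell (D-0079 RESCUE sub-cell R-H, rung LADDER-ABC:A2.RESCUE.H; seat abc-iut-rh-typ-3 gen 5, the row-3 typer of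
record). TAKES NO SIDE on [IUTchIII] Cor. 3.12 or on any author; nothing here asserts abc; H⋆₃ / its cells are HYPOTHESES about OUR typed objects
(`RHHullCapacityNecessaryTyped.CellAt` p458118, `RHHullCapacityNecessaryLin.CellLinAt` p459252, Σ₃ = `RH.SigmaStrataEq.sigmaED` p470530), read BY NAME;
a cell that «holds» means only that abc-iut-w4-d092's explicit-depth refuting engine is SILENT there, never that a licence holds.

WHY THIS FILE. The round-2 reading of record (`plan/rescue/R-H/ROUND2/READING.md` v1.0 §(iv), `MIN-SLICE.md` v1.0 §(iv) LAW) uses, for every kept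
row, «Σ_data ∩ (place w) is an INITIAL SEGMENT of labels j ≤ j₀(w)». For row 3 the kernel had this only at the GENUINE datum `pilotDataOfK` and only
at ODD, TAMELY-INDEXED places (`RHHullCapacityNecessarySlice.cellAt_pilotDataOfK_anti`, p475844: hypotheses `2 < p`, `p ∤ e(w|p)`, through the
integer dictionary `IntCell`). The live window of the programme is the DEEPLY-RAMIFIED stratum (`p ∣ e`, `p = 2` allowed). Here the antitone law
is proved DIRECTLY on the real-valued cell of p458118 (`cellAt_iff_floor_le`: `⌊j²μ − (j+1)(d+a)⌋ ≤ μ + (j+1)(c+b)`, `j = i₀+1`,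
`μ = P_q(x₀)/e(x₀|p) ≥ 0`, `d ≥ 0` the different exponent, `a ≥ 0`, `b` the [IUTchIV] Prop. 1.2 radii, `c = ord_p(2p)`), for ANY `PilotData X`,
ANY prime, ANY place `x₀` and ANY local type. The one non-trivial input is the SHAPE of print's constants: `c + b = (c + ⌊log_p(p·e/(p−1))⌋) − 1/e`
is either `0` or `≥ 1/2` (§2 `depthWidth_zero_or_half_le`), which is exactly what makes a failing cell propagate upward through the floor
(§1 `lt_floor_of_lt_floor`: if `μ + (j+1)β < ⌊j²μ − (j+1)δ⌋` at some `j ≥ 2` then the same holds at every `j + n`).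

RESULTS. §1 real arithmetic (`floor_sub_two_mul_le`, `le_floor_two_mul`, `lt_floor_of_lt_floor`, `sqSubOne_mul_le_of_le`). §2 the width
`c + b ∈ {0} ∪ [1/2, ∞)` (`depthWidth_zero_or_half_le`; the other signs are Literature's `differentOrd_nonneg`, `one_div_le_logRadiusA`,
`floor_logRadius_nonneg`, `absRamificationIdx_pos`, BY NAME; `qPilot_div_ramIdx_nonneg`). §3 **`cellAt_first`** (the `j = 1` cell ALWAYS holds — zero demand), **`cellAt_anti`** (`i₁ ≤ i₂`, cell at `i₂` ⟹ cell
at `i₁`; no side condition), `not_cellAt_mono`, **`cellAt_iff_forall_le`**; the [LIN] twins `cellLinAt_first`, **`cellLinAt_anti`**. §4 consequences: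
**`forall_cellAt_iff_cellAt_top`** («every label ⟺ the top label `i₀ = l⋆ − 1`»), **`hStar_iff_forall_top`** (H⋆₃ ⟺ the top cell at every bad
place), **`mem_sigmaED_of_le`** (Σ₃ is DOWNWARD CLOSED in the label at every prime: the initial-segment law of MIN-SLICE (iv) for row 3, all local
types), `sigmaED_eq_univ_iff_forall_top`, `exists_isTop`. PROOF-ONLY (0 defs). The genuine-datum statement of p475844 is the special case `X := pilotDataOfK D K` (now hypothesis-free).
[cite: Mochizuki2012, IUTchIV Prop. 1.2 (i)(ii) p. 10; IUTchI Ex. 3.2 (iv) p. 71] [cite: DupuyHilado2025, §3.3, §4 (intro)]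
[claim: Mochizuki2012, status: disputed] for every IUT locution. typed ≠ proved; locator ≠ «S holds».
-/

noncomputable section

open Set Function NumberField IsDedekindDomain
open scoped Pointwise

namespace Summit.ABC.IUTFork.Repair.RHHullCapacityNecessaryAnti

open Literature.AnabelianGeometry.AbsoluteAnabelian Literature.IUT.LogThetaLattice Literature.IUT.LogVolume
  Literature.IUT.HodgeTheaters Literature.NumberTheory.NumberFields Literature.NumberTheory.GaloisRepresentations.Ultrametric
open Summit.ABC.IUTFork.Thm311 Summit.ABC.IUTFork.Thm311.Real Summit.ABC.IUTFork.Cor312 Summit.ABC.IUTFork.Cor312.Setting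
  Summit.ABC.IUTFork.Cor312Vol Summit.ABC.IUTFork.Cor312Vol.ExplicitDepth Summit.ABC.IUTFork.Cor312Prov
  Summit.ABC.IUTFork.Repair.RHHullCapacityNecessaryTyped Summit.ABC.IUTFork.Repair.RHHullCapacityNecessaryLin
  Summit.ABC.IUTFork.Repair.RH.SigmaStrataEq

/-! ## §1. Real arithmetic: a failing floor-cell propagates upward in the label -/

/-- The `j = 1` inequality: `⌊μ − 2δ⌋ ≤ μ + 2β` for `δ, β ≥ 0`. [folklore] -/
theorem floor_sub_two_mul_le {μ δ β : ℝ} (hδ : 0 ≤ δ) (hβ : 0 ≤ β) : (⌊μ - 2 * δ⌋ : ℝ) ≤ μ + 2 * β := by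
  have := Int.floor_le (μ - 2 * δ)
  linarith

/-- `t = 0` or `t ≥ 1/2` ⟹ `t ≤ ⌊2t⌋`. (False exactly on `0 < t < 1/2`.) [folklore] -/
theorem le_floor_two_mul {t : ℝ} (ht : t = 0 ∨ 1 / 2 ≤ t) : t ≤ (⌊2 * t⌋ : ℝ) := by
  rcases ht with rfl | ht
  · simp
  · by_cases h1 : 1 ≤ t
    · have := Int.lt_floor_add_one (2 * t)
      linarith
    · rw [not_le] at h1
      have h2 : ⌊2 * t⌋ = 1 := by
        rw [Int.floor_eq_iff]
        constructor <;> push_cast <;> linarith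
      rw [h2]
      push_cast
      linarith

/-- **UPWARD PROPAGATION OF A FAILING CELL.** For `μ, δ ≥ 0` and a width `β ∈ {0} ∪ [1/2, ∞)`: if `μ + (j+1)β < ⌊j²μ − (j+1)δ⌋` at some `j ≥ 2`, then
`μ + (j+n+1)β < ⌊(j+n)²μ − (j+n+1)δ⌋` for every `n`. (From the hypothesis `(j−1)μ > δ + β`, so the left side of the floor grows by at least `2β`
per step while the right side grows by `β`; `nβ ≤ ⌊2nβ⌋` by `le_floor_two_mul`.) [folklore] -/
theorem lt_floor_of_lt_floor {μ δ β : ℝ} (hμ : 0 ≤ μ) (hδ : 0 ≤ δ) (hβ : β = 0 ∨ 1 / 2 ≤ β) {j : ℕ} (hj : 2 ≤ j) (n : ℕ)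
    (h : μ + ((j : ℝ) + 1) * β < (⌊(j : ℝ) ^ 2 * μ - ((j : ℝ) + 1) * δ⌋ : ℝ)) :
    μ + ((j : ℝ) + n + 1) * β < (⌊((j : ℝ) + n) ^ 2 * μ - ((j : ℝ) + n + 1) * δ⌋ : ℝ) := by
  have hβ0 : 0 ≤ β := by
    rcases hβ with h0 | h0
    · rw [h0]
    · linarith
  set X : ℤ := ⌊(j : ℝ) ^ 2 * μ - ((j : ℝ) + 1) * δ⌋ with hX
  have hXle : (X : ℝ) ≤ (j : ℝ) ^ 2 * μ - ((j : ℝ) + 1) * δ := Int.floor_le _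
  have hjR : (2 : ℝ) ≤ j := by exact_mod_cast hj
  have hnR : (0 : ℝ) ≤ n := Nat.cast_nonneg n
  -- `(j − 1) μ > δ + β`
  have key : δ + β < ((j : ℝ) - 1) * μ := by
    by_contra hc
    rw [not_lt] at hc
    have h1 : ((j : ℝ) + 1) * (((j : ℝ) - 1) * μ) ≤ ((j : ℝ) + 1) * (δ + β) :=
      mul_le_mul_of_nonneg_left hc (by linarith)
    have h2 : (j : ℝ) ^ 2 * μ - ((j : ℝ) + 1) * δ - (μ + ((j : ℝ) + 1) * β) =
        ((j : ℝ) + 1) * (((j : ℝ) - 1) * μ) - ((j : ℝ) + 1) * (δ + β) := by ring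
    linarith
  -- one step of the left side gains at least `2β`
  have hstep : 2 * β ≤ (2 * (j : ℝ) + n) * μ - δ := by
    have : (2 * (j : ℝ) + n) * μ = 2 * (((j : ℝ) - 1) * μ) + 2 * μ + (n : ℝ) * μ := by ring
    rw [this]
    nlinarith
  have hgrow : (X : ℝ) + 2 * ((n : ℝ) * β) ≤ ((j : ℝ) + n) ^ 2 * μ - ((j : ℝ) + n + 1) * δ := by
    have hsplit : ((j : ℝ) + n) ^ 2 * μ - ((j : ℝ) + n + 1) * δ =
        ((j : ℝ) ^ 2 * μ - ((j : ℝ) + 1) * δ) + (n : ℝ) * ((2 * (j : ℝ) + n) * μ - δ) := by ring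
    rw [hsplit]
    have h2 : (n : ℝ) * (2 * β) ≤ (n : ℝ) * ((2 * (j : ℝ) + n) * μ - δ) := mul_le_mul_of_nonneg_left hstep hnR
    linarith
  have hfloor : X + ⌊2 * ((n : ℝ) * β)⌋ ≤ ⌊((j : ℝ) + n) ^ 2 * μ - ((j : ℝ) + n + 1) * δ⌋ := by
    have := Int.floor_mono hgrow
    rwa [Int.floor_intCast_add] at this
  have ht : (n : ℝ) * β = 0 ∨ 1 / 2 ≤ (n : ℝ) * β := by
    rcases hβ with h0 | hb
    · left
      rw [h0, mul_zero]
    · rcases Nat.eq_zero_or_pos n with h0 | hn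
      · left
        rw [h0, Nat.cast_zero, zero_mul]
      · right
        have h1 : (1 : ℝ) ≤ n := by exact_mod_cast hn
        nlinarith
  have h2t := le_floor_two_mul ht
  have hcast : ((X : ℝ) + (⌊2 * ((n : ℝ) * β)⌋ : ℝ)) ≤ (⌊((j : ℝ) + n) ^ 2 * μ - ((j : ℝ) + n + 1) * δ⌋ : ℝ) := by
    exact_mod_cast hfloor
  have hexp : μ + ((j : ℝ) + n + 1) * β = (μ + ((j : ℝ) + 1) * β) + (n : ℝ) * β := by ring
  rw [hexp]
  linarith

/-- **The floor-free [LIN] form is antitone**: for `μ ≥ 0`, if `(j₂² − 1)μ ≤ (j₂+1)κ + 1` and `1 ≤ j₁ ≤ j₂` then `(j₁² − 1)μ ≤ (j₁+1)κ + 1`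
(factor `j² − 1 = (j+1)(j−1)`: either `(j₂−1)μ ≤ κ`, and then the same at `j₁`, or `0 < (j₂−1)μ − κ ≤ 1/(j₂+1)` and the product only shrinks).
[folklore] -/
theorem sqSubOne_mul_le_of_le {μ κ : ℝ} (hμ : 0 ≤ μ) {j₁ j₂ : ℕ} (hj₁ : 1 ≤ j₁) (hj : j₁ ≤ j₂)
    (h : (((j₂ : ℝ)) ^ 2 - 1) * μ ≤ ((j₂ : ℝ) + 1) * κ + 1) :
    (((j₁ : ℝ)) ^ 2 - 1) * μ ≤ ((j₁ : ℝ) + 1) * κ + 1 := by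
  have hj₁R : (1 : ℝ) ≤ j₁ := by exact_mod_cast hj₁
  have hjR : (j₁ : ℝ) ≤ j₂ := by exact_mod_cast hj
  have e₁ : (((j₁ : ℝ)) ^ 2 - 1) * μ - ((j₁ : ℝ) + 1) * κ = ((j₁ : ℝ) + 1) * (((j₁ : ℝ) - 1) * μ - κ) := by ring
  have e₂ : (((j₂ : ℝ)) ^ 2 - 1) * μ - ((j₂ : ℝ) + 1) * κ = ((j₂ : ℝ) + 1) * (((j₂ : ℝ) - 1) * μ - κ) := by ring
  by_cases hk : ((j₂ : ℝ) - 1) * μ - κ ≤ 0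
  · -- then `(j₁ − 1)μ − κ ≤ 0` as well
    have h1 : ((j₁ : ℝ) - 1) * μ - κ ≤ 0 := by nlinarith
    have h2 : ((j₁ : ℝ) + 1) * (((j₁ : ℝ) - 1) * μ - κ) ≤ 0 :=
      mul_nonpos_of_nonneg_of_nonpos (by linarith) h1
    linarith
  · rw [not_le] at hk
    -- `(j₂+1)·t₂ ≤ 1` with `t₂ > 0`; `t₁ ≤ t₂` and `j₁ + 1 ≤ j₂ + 1`
    have h2 : ((j₂ : ℝ) + 1) * (((j₂ : ℝ) - 1) * μ - κ) ≤ 1 := by linarith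
    have ht : ((j₁ : ℝ) - 1) * μ - κ ≤ ((j₂ : ℝ) - 1) * μ - κ := by nlinarith
    by_cases hk1 : ((j₁ : ℝ) - 1) * μ - κ ≤ 0
    · have h3 : ((j₁ : ℝ) + 1) * (((j₁ : ℝ) - 1) * μ - κ) ≤ 0 :=
        mul_nonpos_of_nonneg_of_nonpos (by linarith) hk1
      linarith
    · rw [not_le] at hk1
      have h3 : ((j₁ : ℝ) + 1) * (((j₁ : ℝ) - 1) * μ - κ) ≤ ((j₂ : ℝ) + 1) * (((j₂ : ℝ) - 1) * μ - κ) :=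
        mul_le_mul (by linarith) ht hk1.le (by linarith)
      linarith

/-! ## §2. The shape of print's width `c + b` ([IUTchIV] Prop. 1.2): it is `0` or `≥ 1/2` -/

/-- **THE WIDTH `c + b` IS `0` OR `≥ 1/2`** for `e ≥ 1`, `c := ord_p(2p) ∈ {1, 2}`, `b = ⌊log_p(pe/(p−1))⌋ − 1/e` (the floor is `≥ 0`:
`floor_logRadius_nonneg`): `c + ⌊·⌋ ≥ 1` is an integer and `1/e ∈ {1} ∪ (0, 1/2]`; the excluded window `0 < c + b < 1/2` would need `1 < e < 2`.
This dichotomy is what lets a failing floor-cell propagate upward (`lt_floor_of_lt_floor`). [cite: Mochizuki2012, IUTchIV Prop. 1.2 p. 10]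
[claim: Mochizuki2012, status: disputed] -/
theorem depthWidth_zero_or_half_le (p : ℕ) [hp : Fact p.Prime] {e : ℕ} (he : 1 ≤ e) :
    (((if p = 2 then 2 else 1 : ℕ)) : ℝ) + logRadiusB p e = 0 ∨
      1 / 2 ≤ (((if p = 2 then 2 else 1 : ℕ)) : ℝ) + logRadiusB p e := by
  have hB := floor_logRadius_nonneg p he
  set B : ℤ := ⌊Real.log ((p : ℝ) * e / ((p : ℝ) - 1)) / Real.log p⌋ with hBdef
  have hb : logRadiusB p e = (B : ℝ) - 1 / e := rfl
  have hBR : (0 : ℝ) ≤ B := by exact_mod_cast hB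
  rcases Nat.lt_or_ge e 2 with he2 | he2
  · -- `e = 1`: the width is the integer `c + B − 1 ≥ 0`
    obtain rfl : e = 1 := by omega
    rw [hb, Nat.cast_one, div_one]
    set c : ℕ := if p = 2 then 2 else 1 with hcdef
    have hc1 : 1 ≤ c := by rw [hcdef]; split_ifs <;> norm_num
    have hN : (0 : ℤ) ≤ (c : ℤ) + B - 1 := by omega
    have hw : (c : ℝ) + ((B : ℝ) - 1) = (((c : ℤ) + B - 1 : ℤ) : ℝ) := by push_cast; ring
    rw [hw]
    rcases Int.le_iff_eq_or_lt.mp hN with h0 | h1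
    · left
      rw [← h0]; simp
    · right
      have h1' : (1 : ℤ) ≤ (c : ℤ) + B - 1 := h1
      have : (1 : ℝ) ≤ (((c : ℤ) + B - 1 : ℤ) : ℝ) := by exact_mod_cast h1'
      linarith
  · -- `e ≥ 2`: `1/e ≤ 1/2` and `c ≥ 1`
    right
    have hc1 : (1 : ℝ) ≤ (((if p = 2 then 2 else 1 : ℕ)) : ℝ) := by
      split_ifs <;> norm_num
    have he2R : (2 : ℝ) ≤ e := by exact_mod_cast he2
    have : 1 / (e : ℝ) ≤ 1 / 2 := one_div_le_one_div_of_le (by norm_num) he2R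
    rw [hb]
    linarith

/-! ## §3. The [ED] and [LIN] cells are antitone in the label — any `PilotData`, any prime, any place, any local type -/

section Cells

variable {F : Type} [Field F] [NumberField F] (X : PilotData F) {logv : PadicLogs F} (hlog : LogvAnalytic logv)

/-- `μ = P_q(x₀)/e(x₀|p) ≥ 0` (`P_q ≥ 0`: coefficient `ord_v(q_v)/(2l) > 0` on `S`, `0` off `S`). [cite: DupuyHilado2025, §3.3] -/
theorem qPilot_div_ramIdx_nonneg (v : HeightOneSpectrum (𝓞 F)) : 0 ≤ X.qPilot v / (ramIdx F v : ℝ) := by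
  apply div_nonneg _ (Nat.cast_nonneg _)
  by_cases hv : v ∈ X.S
  · rw [X.qPilot_apply_of_mem hv]
    exact div_nonneg (by exact_mod_cast (X.ordq_pos hv).le) X.two_mul_l_pos.le
  · rw [X.qPilot_apply_of_not_mem hv]

/-- **The `j = 1` [ED] cell ALWAYS holds** (label `i₀ = 0`: the cell's demand `(j² − 1)μ` vanishes). [cite: Mochizuki2012, IUTchIV Prop. 1.2 p. 10]
[claim: Mochizuki2012, status: disputed] -/
theorem cellAt_first (pp : Nat.Primes) (i₀ : Fin (thetaIndex X).lstar) (hi : (i₀ : ℕ) = 0) (x₀ : (thetaIndex X).Fibre (.inr pp)) :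
    CellAt X hlog pp i₀ x₀ := by
  haveI hF : Fact (pp : ℕ).Prime := ⟨pp.2⟩
  rw [cellAt_iff_floor_le]
  have he1 : 1 ≤ absRamificationIdx (pp : ℕ) (kOf X pp.1 x₀) := absRamificationIdx_pos (pp : ℕ) _
  have hd : 0 ≤ differentOrd (pp : ℕ) (kOf X pp.1 x₀) := differentOrd_nonneg (pp : ℕ) _
  have ha : 0 ≤ logRadiusA (pp : ℕ) (absRamificationIdx (pp : ℕ) (kOf X pp.1 x₀)) :=
    le_trans (by positivity) (one_div_le_logRadiusA pp.2 he1)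
  have hβ : (0 : ℝ) ≤ (((if (pp : ℕ) = 2 then 2 else 1 : ℕ)) : ℝ) + logRadiusB (pp : ℕ) (absRamificationIdx (pp : ℕ) (kOf X pp.1 x₀)) := by
    rcases depthWidth_zero_or_half_le (pp : ℕ) he1 with h | h
    · rw [h]
    · linarith
  rw [hi]
  simp only [Nat.cast_zero, zero_add, Nat.cast_one, one_pow, one_mul]
  exact floor_sub_two_mul_le (add_nonneg hd ha) hβ

/-- **THE [ED] CELL IS ANTITONE IN THE LABEL — NO SIDE CONDITION**: at any place `x₀ | p` of any pilot datum `X` (any prime incl. `2`, any local type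
incl. `p ∣ e`), if H⋆₃'s cell holds at label `i₂` it holds at every `i₁ ≤ i₂`. Supersedes the tame genuine-datum form `RHHullCapacityNecessarySlice.
cellAt_pilotDataOfK_anti` (p475844; `2 < p`, `p ∤ e`). Proof: a failing cell at `j₁ = i₁+1 ≥ 2` propagates to `j₂` by `lt_floor_of_lt_floor` with the
width dichotomy `depthWidth_zero_or_half_le`; `j₁ = 1` never fails (`cellAt_first`). [cite: Mochizuki2012, IUTchIV Prop. 1.2 (i)(ii) p. 10]
[claim: Mochizuki2012, status: disputed] -/
theorem cellAt_anti (pp : Nat.Primes) (i₁ i₂ : Fin (thetaIndex X).lstar) (x₀ : (thetaIndex X).Fibre (.inr pp)) (hi : (i₁ : ℕ) ≤ (i₂ : ℕ))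
    (h : CellAt X hlog pp i₂ x₀) : CellAt X hlog pp i₁ x₀ := by
  haveI hF : Fact (pp : ℕ).Prime := ⟨pp.2⟩
  rcases Nat.eq_zero_or_pos (i₁ : ℕ) with h0 | hpos
  · exact cellAt_first X hlog pp i₁ h0 x₀
  by_contra hneg
  apply absurd h
  rw [cellAt_iff_floor_le] at hneg ⊢
  rw [not_le] at hneg ⊢
  set μ : ℝ := X.qPilot (placeOf X pp.1 x₀) / (ramIdx F (placeOf X pp.1 x₀) : ℝ) with hμ
  set δ : ℝ := differentOrd (pp : ℕ) (kOf X pp.1 x₀) + logRadiusA (pp : ℕ) (absRamificationIdx (pp : ℕ) (kOf X pp.1 x₀)) with hδ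
  set β : ℝ := (((if (pp : ℕ) = 2 then 2 else 1 : ℕ)) : ℝ) + logRadiusB (pp : ℕ) (absRamificationIdx (pp : ℕ) (kOf X pp.1 x₀)) with hβ
  have he1 : 1 ≤ absRamificationIdx (pp : ℕ) (kOf X pp.1 x₀) := absRamificationIdx_pos (pp : ℕ) _
  have hμ0 : 0 ≤ μ := qPilot_div_ramIdx_nonneg X (placeOf X pp.1 x₀)
  have hδ0 : 0 ≤ δ := add_nonneg (differentOrd_nonneg (pp : ℕ) _) (le_trans (by positivity) (one_div_le_logRadiusA pp.2 he1))
  have hβs : β = 0 ∨ 1 / 2 ≤ β := depthWidth_zero_or_half_le (pp : ℕ) he1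
  -- `j₁ = i₁ + 1 ≥ 2`, `n = i₂ − i₁`
  obtain ⟨n, hn⟩ : ∃ n : ℕ, (i₂ : ℕ) = (i₁ : ℕ) + n := ⟨i₂ - i₁, by omega⟩
  have hj : 2 ≤ (i₁ : ℕ) + 1 := by omega
  have key := lt_floor_of_lt_floor hμ0 hδ0 hβs hj n (by
    have e1 : ((((i₁ : ℕ) + 1 : ℕ) : ℝ)) = ((i₁ : ℕ) : ℝ) + 1 := by push_cast; ring
    have e2 : (((i₁ : ℕ) : ℝ) + 2) = (((i₁ : ℕ) + 1 : ℕ) : ℝ) + 1 := by push_cast; ring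
    rw [e2] at hneg
    exact hneg)
  have e3 : ((((i₂ : ℕ) + 1 : ℕ) : ℝ)) = ((((i₁ : ℕ) + 1 : ℕ) : ℝ)) + n := by rw [hn]; push_cast; ring
  have e4 : (((i₂ : ℕ) : ℝ) + 2) = ((((i₁ : ℕ) + 1 : ℕ) : ℝ)) + n + 1 := by rw [hn]; push_cast; ring
  rw [e3, e4]
  exact key

/-- Contrapositive: a FAILING [ED] cell at label `i₁` fails at every `i₂ ≥ i₁` (the refuted labels form a FINAL segment). [claim: Mochizuki2012, status: disputed] -/
theorem not_cellAt_mono (pp : Nat.Primes) (i₁ i₂ : Fin (thetaIndex X).lstar) (x₀ : (thetaIndex X).Fibre (.inr pp)) (hi : (i₁ : ℕ) ≤ (i₂ : ℕ))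
    (h : ¬ CellAt X hlog pp i₁ x₀) : ¬ CellAt X hlog pp i₂ x₀ :=
  fun h₂ => h (cellAt_anti X hlog pp i₁ i₂ x₀ hi h₂)

/-- **INITIAL SEGMENT**: the cell at `i₂` holds iff it holds at EVERY `i₁ ≤ i₂`. [claim: Mochizuki2012, status: disputed] -/
theorem cellAt_iff_forall_le (pp : Nat.Primes) (i₂ : Fin (thetaIndex X).lstar) (x₀ : (thetaIndex X).Fibre (.inr pp)) :
    CellAt X hlog pp i₂ x₀ ↔ ∀ i₁ : Fin (thetaIndex X).lstar, (i₁ : ℕ) ≤ (i₂ : ℕ) → CellAt X hlog pp i₁ x₀ :=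
  ⟨fun h i₁ hi => cellAt_anti X hlog pp i₁ i₂ x₀ hi h, fun h => h i₂ le_rfl⟩

/-- **The `j = 1` [LIN] cell ALWAYS holds**: `0 ≤ 2(d + a + b) + 1` by `d ≥ 0` and `a + b ≥ 0`. [cite: Mochizuki2012, IUTchIV Prop. 1.2 p. 10]
[claim: Mochizuki2012, status: disputed] -/
theorem cellLinAt_first (pp : Nat.Primes) (i₀ : Fin (thetaIndex X).lstar) (hi : (i₀ : ℕ) = 0) (x₀ : (thetaIndex X).Fibre (.inr pp)) :
    CellLinAt X pp i₀ x₀ := by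
  haveI hF : Fact (pp : ℕ).Prime := ⟨pp.2⟩
  unfold CellLinAt
  have hd : 0 ≤ differentOrd (pp : ℕ) (kOf X pp.1 x₀) := differentOrd_nonneg (pp : ℕ) _
  -- `a + b ≥ 0`: `a ≥ 1/e` (`one_div_le_logRadiusA`) and `b = ⌊·⌋ − 1/e` with `⌊·⌋ ≥ 0` (`floor_logRadius_nonneg`)
  have he1 : 1 ≤ absRamificationIdx (pp : ℕ) (kOf X pp.1 x₀) := absRamificationIdx_pos (pp : ℕ) _
  have ha := one_div_le_logRadiusA pp.2 he1
  have hB : (0 : ℝ) ≤ (⌊Real.log (((pp : ℕ) : ℝ) * (absRamificationIdx (pp : ℕ) (kOf X pp.1 x₀) : ℕ) / (((pp : ℕ) : ℝ) - 1)) /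
      Real.log ((pp : ℕ) : ℝ)⌋ : ℝ) := by exact_mod_cast floor_logRadius_nonneg (pp : ℕ) he1
  have hab : 0 ≤ logRadiusA (pp : ℕ) (absRamificationIdx (pp : ℕ) (kOf X pp.1 x₀)) +
      logRadiusB (pp : ℕ) (absRamificationIdx (pp : ℕ) (kOf X pp.1 x₀)) := by
    unfold logRadiusB
    linarith
  rw [hi]
  simp only [Nat.cast_zero, zero_add, Nat.cast_one, one_pow, sub_self, zero_mul]
  linarith

/-- **THE [LIN] CELL IS ANTITONE IN THE LABEL — NO SIDE CONDITION** (any pilot datum, prime, place, local type): floor-free form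
`(j² − 1)μ ≤ (j+1)(d+a+b) + 1`, `sqSubOne_mul_le_of_le`. Supersedes the tame genuine-datum `RHHullCapacityNecessarySlice.cellLinAt_pilotDataOfK_anti`.
[cite: Mochizuki2012, IUTchIV Prop. 1.2 (i)(ii) p. 10] [claim: Mochizuki2012, status: disputed] -/
theorem cellLinAt_anti (pp : Nat.Primes) (i₁ i₂ : Fin (thetaIndex X).lstar) (x₀ : (thetaIndex X).Fibre (.inr pp)) (hi : (i₁ : ℕ) ≤ (i₂ : ℕ))
    (h : CellLinAt X pp i₂ x₀) : CellLinAt X pp i₁ x₀ := by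
  haveI hF : Fact (pp : ℕ).Prime := ⟨pp.2⟩
  unfold CellLinAt at h ⊢
  have hμ0 := qPilot_div_ramIdx_nonneg X (placeOf X pp.1 x₀)
  have e1 : ((((i₁ : ℕ) + 1 : ℕ) : ℝ)) = ((i₁ : ℕ) : ℝ) + 1 := by push_cast; ring
  have e2 : ((((i₂ : ℕ) + 1 : ℕ) : ℝ)) = ((i₂ : ℕ) : ℝ) + 1 := by push_cast; ring
  have e3 : (((i₁ : ℕ) : ℝ) + 2) = ((((i₁ : ℕ) + 1 : ℕ) : ℝ)) + 1 := by push_cast; ring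
  have e4 : (((i₂ : ℕ) : ℝ) + 2) = ((((i₂ : ℕ) + 1 : ℕ) : ℝ)) + 1 := by push_cast; ring
  rw [e3]
  rw [e4] at h
  exact sqSubOne_mul_le_of_le hμ0 (by omega) (by omega) h

end Cells

/-! ## §4. Consequences: «every label ⟺ the top label», H⋆₃ ⟺ top cells, Σ₃ is downward closed in the label -/

section Consequences

variable {F : Type} [Field F] [NumberField F] (X : PilotData F) {logv : PadicLogs F} (hlog : LogvAnalytic logv)

/-- Any label is `≤` the TOP label `i_top = l⋆ − 1` (i.e. `j = l⋆ = (l−1)/2`). [folklore] -/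
theorem le_of_isTop (iTop : Fin (thetaIndex X).lstar) (htop : (iTop : ℕ) + 1 = (thetaIndex X).lstar) (i : Fin (thetaIndex X).lstar) :
    (i : ℕ) ≤ (iTop : ℕ) := by
  have := i.2
  omega

/-- **WHOLE PLACE IN Σ₃ ⟺ ITS TOP CELL**: H⋆₃'s [ED] cell at every label of the place `x₀` iff the cell at the top label `i_top = l⋆ − 1` (MIN-SLICE
(iv) «Q1′ = Q3» for row 3: the initial segment reaches `l⋆` iff the binding top label passes). [claim: Mochizuki2012, status: disputed] -/
theorem forall_cellAt_iff_cellAt_top (pp : Nat.Primes) (x₀ : (thetaIndex X).Fibre (.inr pp))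
    (iTop : Fin (thetaIndex X).lstar) (htop : (iTop : ℕ) + 1 = (thetaIndex X).lstar) :
    (∀ i₀ : Fin (thetaIndex X).lstar, CellAt X hlog pp i₀ x₀) ↔ CellAt X hlog pp iTop x₀ :=
  ⟨fun h => h _, fun h i₀ => cellAt_anti X hlog pp i₀ iTop x₀ (le_of_isTop X iTop htop i₀) h⟩

/-- **H⋆₃ ⟺ THE TOP CELL AT EVERY BAD PLACE** (row 3's k1 recipe «margin_ED ≥ 0 at the binding (top) label» is EXACT for the datum-level hypothesis,
for every local type). [claim: Mochizuki2012, status: disputed] -/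
theorem hStar_iff_forall_top (iTop : Fin (thetaIndex X).lstar) (htop : (iTop : ℕ) + 1 = (thetaIndex X).lstar) :
    HStar X hlog ↔ ∀ (pp : Nat.Primes) (x₀ : (thetaIndex X).Fibre (.inr pp)),
      (haveI : Fact (pp : ℕ).Prime := ⟨pp.2⟩; placeOf X pp.1 x₀ ∈ X.S) → CellAt X hlog pp iTop x₀ :=
  ⟨fun h pp x₀ hx => h pp x₀ hx _, fun h pp x₀ hx => (forall_cellAt_iff_cellAt_top X hlog pp x₀ iTop htop).2 (h pp x₀ hx)⟩

/-- The [LIN] twin: H⋆₃[LIN]'s cell at every label of a place iff at the top label. [claim: Mochizuki2012, status: disputed] -/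
theorem forall_cellLinAt_iff_cellLinAt_top (pp : Nat.Primes) (x₀ : (thetaIndex X).Fibre (.inr pp))
    (iTop : Fin (thetaIndex X).lstar) (htop : (iTop : ℕ) + 1 = (thetaIndex X).lstar) :
    (∀ i₀ : Fin (thetaIndex X).lstar, CellLinAt X pp i₀ x₀) ↔ CellLinAt X pp iTop x₀ :=
  ⟨fun h => h _, fun h i₀ => cellLinAt_anti X pp i₀ iTop x₀ (le_of_isTop X iTop htop i₀) h⟩

/-- **Σ₃ IS DOWNWARD CLOSED IN THE LABEL** (abc-iut-rh2-q2-eq's `RH.SigmaStrataEq.sigmaED`, p470530): if the cell `(i₂, v_ℚ)` lies in Σ₃ then so does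
`(i₁, v_ℚ)` for every `i₁ ≤ i₂` — at every prime, Σ₃ ∩ (fibre) is an INITIAL SEGMENT of labels (MIN-SLICE (iv) LAW for row 3, all local types;
archimedean cells are unconstrained). [claim: Mochizuki2012, status: disputed] -/
theorem mem_sigmaED_of_le {i₁ i₂ : Fin (thetaIndex X).lstar} {vQ : (thetaIndex X).VQ} (hi : (i₁ : ℕ) ≤ (i₂ : ℕ))
    (h : ((i₂, vQ) : Fin (thetaIndex X).lstar × (thetaIndex X).VQ) ∈ sigmaED X hlog) :
    ((i₁, vQ) : Fin (thetaIndex X).lstar × (thetaIndex X).VQ) ∈ sigmaED X hlog :=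
  fun pp hpp x₀ hx => cellAt_anti X hlog pp i₁ i₂ x₀ hi (h pp hpp x₀ hx)

/-- A cell outside Σ₃ drags every HIGHER label of the same fibre out of Σ₃. [claim: Mochizuki2012, status: disputed] -/
theorem not_mem_sigmaED_of_le {i₁ i₂ : Fin (thetaIndex X).lstar} {vQ : (thetaIndex X).VQ} (hi : (i₁ : ℕ) ≤ (i₂ : ℕ))
    (h : ((i₁, vQ) : Fin (thetaIndex X).lstar × (thetaIndex X).VQ) ∉ sigmaED X hlog) :
    ((i₂, vQ) : Fin (thetaIndex X).lstar × (thetaIndex X).VQ) ∉ sigmaED X hlog :=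
  fun h₂ => h (mem_sigmaED_of_le X hlog hi h₂)

/-- **Σ₃ = everything ⟺ every TOP cell `(l⋆ − 1, v_ℚ)` lies in Σ₃.** [claim: Mochizuki2012, status: disputed] -/
theorem sigmaED_eq_univ_iff_forall_top (iTop : Fin (thetaIndex X).lstar) (htop : (iTop : ℕ) + 1 = (thetaIndex X).lstar) :
    sigmaED X hlog = Set.univ ↔ ∀ vQ : (thetaIndex X).VQ, ((iTop, vQ) : Fin (thetaIndex X).lstar × (thetaIndex X).VQ) ∈ sigmaED X hlog := by
  constructor
  · intro h vQ
    rw [h]; exact Set.mem_univ _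
  · intro h
    exact Set.eq_univ_of_forall fun c => mem_sigmaED_of_le X hlog (le_of_isTop X iTop htop c.1) (h c.2)

/-- The top label EXISTS (`l⋆ ≥ 2`), so the `iTop`-hypothesis of the three statements above is always dischargeable. [folklore] -/
theorem exists_isTop : ∃ iTop : Fin (thetaIndex X).lstar, (iTop : ℕ) + 1 = (thetaIndex X).lstar :=
  ⟨⟨(thetaIndex X).lstar - 1, by have := (thetaIndex X).two_le_lstar; omega⟩, by
    have := (thetaIndex X).two_le_lstar
    show (thetaIndex X).lstar - 1 + 1 = _
    omega⟩

end Consequences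

end Summit.ABC.IUTFork.Repair.RHHullCapacityNecessaryAnti

end
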